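import Literature.MathematicalPhysics.QuantumLattice.TorusSectorPressureTypeBoundFillingBox
import Literature.MathematicalPhysics.QuantumLattice.HubbardThermalAxisWindow
import HarnessLib

/-!
# Thermal energy windows on a FILLING INTERVAL from two C2 types and a C1 (Markov) certificate — every torus
# limit at every density between the two certified types

Family `hubbard` (topic `MathematicalPhysics/QuantumLattice`); the filling-interval companions of
`HubbardThermalAxisWindowAllTori`. The C2 pressure floor at the interpolated density `n = (1−λ)ρ₁ + λρ₂` is the
chord `(1−λ)W₁ + λW₂` of the two type values
(`InfVolFermionState.eventually_typeFreeEntropy_chord_mul_sq_le_log_partitionFn_allTori`,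
`TorusSectorPressureTypeBoundFillingBox`); the C1 pressure ceiling `c − β' μ n` of a rectangle Markov certificate
(`HubbardTorusMarkovRectWindow`) is affine in `n` by itself. Hence ONE pair of certified types and ONE Markov
certificate word the thermal energy of EVERY torus limit at EVERY density of `[ρ₁, ρ₂]`:

* `IsTorusLimitOfMixture.meanEnergy_hubbardTTPrime_le_of_typeClass₂_of_rectMarkovCertificate` — upper edge
  `e_Φ(ω) ≤ ((c − β_h μ n) − ((1−λ)W₁ + λW₂))/(β − β_h)` (C1 at `β_h < β`);
* `IsTorusLimitOfMixture.le_meanEnergy_hubbardTTPrime_of_typeClass₂_of_rectMarkovCertificate` — lower edge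
  `(((1−λ)W₁ + λW₂) − (c − β_c μ n))/(β_c − β) ≤ e_Φ(ω)` (C1 at `β_c > β`).

Both bounds are affine in `λ` (i.e. in `n`), so on a filling box they are read at the two endpoints (filling leg of
BOX → WORD, `T > 0`, free-energy route). Everything is PROVED; no definition, no named fact.

## References

* R. B. Israel, *Convexity in the Theory of Lattice Gases* (1979), Lemma II.3.1. [cite: Israel1979, Lemma II.3.1]
* D. Poulin, M. B. Hastings, Phys. Rev. Lett. 106 (2011) 080403, eqs. (3)–(8). [cite: PoulinHastings2011, eqs. (3)–(8)]
* D. Ruelle, *Statistical Mechanics: Rigorous Results* (1969), §3.3, §3.4.3. [cite: Ruelle1969, §3.3]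
-/

noncomputable section

namespace Literature.MathematicalPhysics.QuantumLattice

open Matrix Finset HubbardWave0 ThermodynamicLimit LiebThm1 AndersonCluster Literature.Probability.LatticeModels
open _root_.Filter
open scoped _root_.Topology ComplexOrder BigOperators

namespace InfVolFermionState

variable {t U n β : ℝ} {ω : InfVolFermionState 2} {Ls : ℕ → ℕ}

/-- **Upper edge of the thermal energy window at an interpolated filling, every torus limit** (square-lattice
Hubbard model, `t' = 0`). C2 data: box `a × b`, sectors `S`, floors `0 < z_s ≤ Re Z_β(H^open_{a×b}; s)`, two balanced
base types `m₁` (`q₁`, `A₁`), `m₂` (`q₂`, `A₂`) supported in `S` with `A₁q₂ ≤ A₂q₁`, `λ ∈ [0,1]`, density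
`n q₁q₂ab = 2((1−λ)A₁q₂ + λA₂q₁)`, `0 ≤ n < 2`; `ω` a torus limit along ANY `Ls → ∞`. C1 data: rectangle `a' × b'`
(`a', b' ≥ 2`) at `(β_h, μ)`, `0 < β_h < β`, with annihilator, dual `L_B` and constant `c`. Then
`e_Φ(ω) ≤ ((c − β_h μ n) − ((1−λ)W₁ + λW₂))/(β − β_h)`, `W_i = (q_i log q_i − Σ m_i log m_i + Σ m_i log z_s)/(q_i a b)`.
[cite: Israel1979, Lemma II.3.1] [cite: PoulinHastings2011, eqs. (3)–(8)] [cite: Ruelle1969, §3.3] -/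
theorem IsTorusLimitOfMixture.meanEnergy_hubbardTTPrime_le_of_typeClass₂_of_rectMarkovCertificate
    (hn0 : 0 ≤ n) (hn2 : n < 2)
    (h : ω.IsTorusLimitOfMixture (sectorGibbsCount n) (fun L => sectorGibbsWeightTT' β t 0 U n L)
      (fun L => sectorGibbsVectorTT' t 0 U n L) Ls)
    (hLs : Tendsto Ls atTop atTop) {βh : ℝ} (hβh : 0 < βh) (hlt : βh < β)
    -- C2 at `β`: two types
    {a b : ℕ} (ha : 1 ≤ a) (hb : 1 ≤ b) (S : Finset (ℕ × ℕ)) (m₁ m₂ : ℕ × ℕ → ℕ) {q₁ q₂ A₁ A₂ : ℕ}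
    (hq₁ : 1 ≤ q₁) (hq₂ : 1 ≤ q₂) (hm₁S : ∀ s, m₁ s ≠ 0 → s ∈ S) (hm₂S : ∀ s, m₂ s ≠ 0 → s ∈ S)
    (hsum₁ : ∑ s ∈ S, m₁ s = q₁) (hsum₂ : ∑ s ∈ S, m₂ s = q₂)
    (hA₁ : ∑ s ∈ S, m₁ s * s.1 = A₁) (hB₁ : ∑ s ∈ S, m₁ s * s.2 = A₁)
    (hA₂ : ∑ s ∈ S, m₂ s * s.1 = A₂) (hB₂ : ∑ s ∈ S, m₂ s * s.2 = A₂) (hρ : A₁ * q₂ ≤ A₂ * q₁)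
    {lam : ℝ} (hlam0 : 0 ≤ lam) (hlam1 : lam ≤ 1)
    (hn : n * ((q₁ : ℝ) * q₂ * a * b) = 2 * ((1 - lam) * A₁ * q₂ + lam * A₂ * q₁))
    {z : ℕ × ℕ → ℝ} (hz0 : ∀ s ∈ S, 0 < z s)
    (hz : ∀ s ∈ S, z s ≤ (partitionFn β (spinSectorHamiltonian s.1 s.2 (hubbardOpenBoxTT' a b t 0 U))).re)
    -- C1 at `βh`
    (μ : ℝ) {a' b' : ℕ} (ha' : 2 ≤ a') (hb' : 2 ≤ b')
    {ι : Type*} (sι : Finset ι) (Sw : ι → Finset (Site 2)) (hS : ∀ i, Sw i ⊆ rectWindow a' b') (zw : ι → Site 2)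
    (hzw : ∀ i, shiftSet (zw i) (Sw i) ⊆ rectWindow a' b') {O : ∀ i, FermionOp (Sw i)}
    (hO : ∀ i ∈ sι, (O i).IsHermitian) (g : ι → ℝ)
    {LB : FermionOp ((rectWindow a' b').erase (mkSite2 (a' - 1) (b' - 1)))} (hLB : LB.IsHermitian) {c : ℝ}
    (hcert : ((Real.exp c : ℂ) • cfc Real.exp LB -
      fermionPartialTrace (PolySite.incl (Finset.erase_subset (mkSite2 (a' - 1) (b' - 1)) (rectWindow a' b')))
        (cfc Real.exp (-((βh : ℂ) • (cornerEnergyRep (rectWindow a' b') (mkSite2 (a' - 1) (b' - 1)) t U μ +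
            windowAnnihilator sι (rectWindow a' b') Sw hS zw hzw O g)) +
          fermionEmbed (PolySite.incl (Finset.erase_subset (mkSite2 (a' - 1) (b' - 1)) (rectWindow a' b'))) LB))).PosSemidef) :
    ω.meanEnergy (hubbardTTPrimeFermionInteraction t 0 U) 1 ≤
      ((c - βh * μ * n) - ((1 - lam) * (((q₁ : ℝ) * Real.log q₁ - ∑ s ∈ S, (m₁ s : ℝ) * Real.log (m₁ s) +
          ∑ s ∈ S, (m₁ s : ℝ) * Real.log (z s)) / ((q₁ : ℝ) * a * b)) +
        lam * (((q₂ : ℝ) * Real.log q₂ - ∑ s ∈ S, (m₂ s : ℝ) * Real.log (m₂ s) +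
          ∑ s ∈ S, (m₂ s : ℝ) * Real.log (z s)) / ((q₂ : ℝ) * a * b)))) / (β - βh) := by
  have hβ : 0 ≤ β := (hβh.trans hlt).le
  refine h.meanEnergy_hubbardTTPrime_le_of_eventually_pressure_bounds hn0 hn2.le hLs hβh hlt
    (fun ε hε => eventually_typeFreeEntropy_chord_mul_sq_le_log_partitionFn_allTori t 0 U n hβ ha hb S m₁ m₂ hq₁
      hq₂ hm₁S hm₂S hsum₁ hsum₂ hA₁ hB₁ hA₂ hB₂ hρ hlam0 hlam1 hn hn2 hz0 hz hLs hε)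
    (fun ε hε => ?_)
  have hKTI : ∀ (L : ℕ) [NeZero L], ∀ w : TorusSite 2 L,
      relabel (Orb.translate w) (hubbardTorusTT' L t 0 U - (μ : ℂ) • totalNumber) =
        hubbardTorusTT' L t 0 U - (μ : ℂ) • totalNumber := fun L _ w => by
    rw [hubbardTorusTT'_zero_sub_mu, relabel_translate_hubbardTorusWith]
  exact eventually_log_partitionFn_sectorHamiltonianTT'_le_of_clusterCertificate t U μ βh hn0 hn2.le hLs
    (rectCorner_mem_rectWindow (by omega) (by omega)) toLex_le_toLex_rectCorner
    (rectWindow_subset_halfOpenBox_max a' b')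
    (fun i => bondWeightSum_cornerBondWeight (rectCorner_mem_rectWindow (by omega) (by omega))
      (rectCorner_sub_unitVec_mem_rectWindow ha' hb' i))
    (siteWeightSum_cornerSiteWeight (rectCorner_mem_rectWindow (by omega) (by omega)))
    (siteWeightSum_mul_cornerSiteWeight (rectCorner_mem_rectWindow (by omega) (by omega)) (-μ))
    (isHermitian_windowAnnihilator sι _ Sw hS zw hzw hO g)
    (fun L _ hL3 hℓL => trace_window_mul_windowAnnihilator (relabel_translate_gibbsDensity L (hKTI L) βh)
      _ sι Sw hS zw hzw O g) hLB hcert hε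

/-- **Lower edge of the thermal energy window at an interpolated filling, every torus limit** (same C2 data;
the C1 certificate at a colder `β_c > β`): `(((1−λ)W₁ + λW₂) − (c − β_c μ n))/(β_c − β) ≤ e_Φ(ω)`.
[cite: Israel1979, Lemma II.3.1] [cite: PoulinHastings2011, eqs. (3)–(8)] [cite: Ruelle1969, §3.3] -/
theorem IsTorusLimitOfMixture.le_meanEnergy_hubbardTTPrime_of_typeClass₂_of_rectMarkovCertificate
    (hn0 : 0 ≤ n) (hn2 : n < 2)
    (h : ω.IsTorusLimitOfMixture (sectorGibbsCount n) (fun L => sectorGibbsWeightTT' β t 0 U n L)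
      (fun L => sectorGibbsVectorTT' t 0 U n L) Ls)
    (hLs : Tendsto Ls atTop atTop) (hβ : 0 < β) {βc : ℝ} (hlt : β < βc)
    -- C2 at `β`: two types
    {a b : ℕ} (ha : 1 ≤ a) (hb : 1 ≤ b) (S : Finset (ℕ × ℕ)) (m₁ m₂ : ℕ × ℕ → ℕ) {q₁ q₂ A₁ A₂ : ℕ}
    (hq₁ : 1 ≤ q₁) (hq₂ : 1 ≤ q₂) (hm₁S : ∀ s, m₁ s ≠ 0 → s ∈ S) (hm₂S : ∀ s, m₂ s ≠ 0 → s ∈ S)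
    (hsum₁ : ∑ s ∈ S, m₁ s = q₁) (hsum₂ : ∑ s ∈ S, m₂ s = q₂)
    (hA₁ : ∑ s ∈ S, m₁ s * s.1 = A₁) (hB₁ : ∑ s ∈ S, m₁ s * s.2 = A₁)
    (hA₂ : ∑ s ∈ S, m₂ s * s.1 = A₂) (hB₂ : ∑ s ∈ S, m₂ s * s.2 = A₂) (hρ : A₁ * q₂ ≤ A₂ * q₁)
    {lam : ℝ} (hlam0 : 0 ≤ lam) (hlam1 : lam ≤ 1)
    (hn : n * ((q₁ : ℝ) * q₂ * a * b) = 2 * ((1 - lam) * A₁ * q₂ + lam * A₂ * q₁))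
    {z : ℕ × ℕ → ℝ} (hz0 : ∀ s ∈ S, 0 < z s)
    (hz : ∀ s ∈ S, z s ≤ (partitionFn β (spinSectorHamiltonian s.1 s.2 (hubbardOpenBoxTT' a b t 0 U))).re)
    -- C1 at `βc`
    (μ : ℝ) {a' b' : ℕ} (ha' : 2 ≤ a') (hb' : 2 ≤ b')
    {ι : Type*} (sι : Finset ι) (Sw : ι → Finset (Site 2)) (hS : ∀ i, Sw i ⊆ rectWindow a' b') (zw : ι → Site 2)
    (hzw : ∀ i, shiftSet (zw i) (Sw i) ⊆ rectWindow a' b') {O : ∀ i, FermionOp (Sw i)}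
    (hO : ∀ i ∈ sι, (O i).IsHermitian) (g : ι → ℝ)
    {LB : FermionOp ((rectWindow a' b').erase (mkSite2 (a' - 1) (b' - 1)))} (hLB : LB.IsHermitian) {c : ℝ}
    (hcert : ((Real.exp c : ℂ) • cfc Real.exp LB -
      fermionPartialTrace (PolySite.incl (Finset.erase_subset (mkSite2 (a' - 1) (b' - 1)) (rectWindow a' b')))
        (cfc Real.exp (-((βc : ℂ) • (cornerEnergyRep (rectWindow a' b') (mkSite2 (a' - 1) (b' - 1)) t U μ +
            windowAnnihilator sι (rectWindow a' b') Sw hS zw hzw O g)) +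
          fermionEmbed (PolySite.incl (Finset.erase_subset (mkSite2 (a' - 1) (b' - 1)) (rectWindow a' b'))) LB))).PosSemidef) :
    (((1 - lam) * (((q₁ : ℝ) * Real.log q₁ - ∑ s ∈ S, (m₁ s : ℝ) * Real.log (m₁ s) +
          ∑ s ∈ S, (m₁ s : ℝ) * Real.log (z s)) / ((q₁ : ℝ) * a * b)) +
        lam * (((q₂ : ℝ) * Real.log q₂ - ∑ s ∈ S, (m₂ s : ℝ) * Real.log (m₂ s) +
          ∑ s ∈ S, (m₂ s : ℝ) * Real.log (z s)) / ((q₂ : ℝ) * a * b))) - (c - βc * μ * n)) / (βc - β) ≤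
      ω.meanEnergy (hubbardTTPrimeFermionInteraction t 0 U) 1 := by
  refine h.le_meanEnergy_hubbardTTPrime_of_eventually_pressure_bounds hn0 hn2.le hLs hβ hlt
    (fun ε hε => eventually_typeFreeEntropy_chord_mul_sq_le_log_partitionFn_allTori t 0 U n hβ.le ha hb S m₁ m₂
      hq₁ hq₂ hm₁S hm₂S hsum₁ hsum₂ hA₁ hB₁ hA₂ hB₂ hρ hlam0 hlam1 hn hn2 hz0 hz hLs hε)
    (fun ε hε => ?_)
  have hKTI : ∀ (L : ℕ) [NeZero L], ∀ w : TorusSite 2 L,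
      relabel (Orb.translate w) (hubbardTorusTT' L t 0 U - (μ : ℂ) • totalNumber) =
        hubbardTorusTT' L t 0 U - (μ : ℂ) • totalNumber := fun L _ w => by
    rw [hubbardTorusTT'_zero_sub_mu, relabel_translate_hubbardTorusWith]
  exact eventually_log_partitionFn_sectorHamiltonianTT'_le_of_clusterCertificate t U μ βc hn0 hn2.le hLs
    (rectCorner_mem_rectWindow (by omega) (by omega)) toLex_le_toLex_rectCorner
    (rectWindow_subset_halfOpenBox_max a' b')
    (fun i => bondWeightSum_cornerBondWeight (rectCorner_mem_rectWindow (by omega) (by omega))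
      (rectCorner_sub_unitVec_mem_rectWindow ha' hb' i))
    (siteWeightSum_cornerSiteWeight (rectCorner_mem_rectWindow (by omega) (by omega)))
    (siteWeightSum_mul_cornerSiteWeight (rectCorner_mem_rectWindow (by omega) (by omega)) (-μ))
    (isHermitian_windowAnnihilator sι _ Sw hS zw hzw hO g)
    (fun L _ hL3 hℓL => trace_window_mul_windowAnnihilator (relabel_translate_gibbsDensity L (hKTI L) βc)
      _ sι Sw hS zw hzw O g) hLB hcert hε

end InfVolFermionState

end Literature.MathematicalPhysics.QuantumLattice

end
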